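import Summits.MatrixMultiplication.MatrixMultiplication.Theorems.SoloInformedValLabelled

/-!
# SoloInformedValCompleteBlock — one complete block of a labelled triple is linear

Sequel of `SoloInformedValLabelled` (K. Pratt, arXiv:2309.03878, Def. 3.2; labelled triples `Labelled`).
A COMPLETE BLOCK of a labelled triple `(A, B, C; t)` with labellings `lA : G → I × J`, `lB : G → J × K`,
`lC : G → K × I` is a box `I₀ × J₀ × K₀` of labels every triple `(i, j, k)` of which is realised by a solution:
`a + b + c = t` with `lA a = (i, j)`, `lB b = (j, k)`, `lC c = (k, i)` (`CompleteBlock`).  We prove the abelian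
packing bound

* `Labelled.card_block_le`: `#I₀ · #J₀ · #K₀ ≤ |G|` for every complete block of a labelled triple in a finite
  additive commutative group `G`.

Proof: writing `a(i,j)`, `b(j,k)`, `c(k,i)` for the (unique) elements with the given labels, the functional equation
`a(i,j) + b(j,k) + c(k,i) = t` on the box makes `b(j,k) - b(j,k')` independent of `j`
(`Labelled.fb_sub_fb_eq`), and then `(i, j, k) ↦ a(i,j) + b(j₀,k)` is injective on the box: a coincidence
`a(i,j) + b(j₀,k) = a(i',j') + b(j₀,k')` produces the solution `a(i,j) + b(j',k) + c(k',i') = t`, whose labels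
must match, forcing `(i,j,k) = (i',j',k')` — this is the triple-product property of the underlying sets and its
packing bound `|S| |T| |U| ≤ |G|` in abelian groups [Cohn–Umans 2003, Lemma 3.1's abelian obstruction;
Cohn–Kleinberg–Szegedy–Umans 2005].  Consequently a labelled triple consisting of ONE complete block has at most
`|G|` solutions: superlinear values of `Val` in the labelled class come only from many incomplete or many small
blocks (dossier `val-superlinear.md` §14.3, §15.3).  solo-informed MatrixMultiplication, gen 74.
-/

namespace Summit.MatrixMultiplication.MatrixMultiplication.Theorems.SoloVal

open Finset

section CompleteBlock

variable {G : Type*} [AddCommGroup G]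
variable {I J K : Type*}

/-- A COMPLETE BLOCK `I₀ × J₀ × K₀` of the labelled triple `(A, B, C; t)`: every label triple of the box is carried
by a solution. -/
def CompleteBlock (A B C : Finset G) (t : G) (lA : G → I × J) (lB : G → J × K) (lC : G → K × I)
    (I₀ : Finset I) (J₀ : Finset J) (K₀ : Finset K) : Prop :=
  ∀ i ∈ I₀, ∀ j ∈ J₀, ∀ k ∈ K₀, ∃ a ∈ A, ∃ b ∈ B, ∃ c ∈ C,
    a + b + c = t ∧ lA a = (i, j) ∧ lB b = (j, k) ∧ lC c = (k, i)

variable {A B C : Finset G} {t : G} {lA : G → I × J} {lB : G → J × K} {lC : G → K × I}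
variable {I₀ : Finset I} {J₀ : Finset J} {K₀ : Finset K}

/-- Label-indexed elements: in a labelled triple, elements of `A`, `B`, `C` with prescribed labels on a complete
block exist as functions `fa i j ∈ A`, `fb j k ∈ B`, `fc k i ∈ C` (any solution with those labels consists of
exactly these elements, by injectivity of the labellings), and they satisfy the functional equation
`fa i j + fb j k + fc k i = t` on the block. -/
theorem Labelled.exists_blockFunctions (hL : Labelled A B C t lA lB lC)
    (hblk : CompleteBlock A B C t lA lB lC I₀ J₀ K₀) (hI : I₀.Nonempty) (hJ : J₀.Nonempty) (hK : K₀.Nonempty) :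
    ∃ (fa : I → J → G) (fb : J → K → G) (fc : K → I → G),
      (∀ i ∈ I₀, ∀ j ∈ J₀, fa i j ∈ A ∧ lA (fa i j) = (i, j)) ∧
      (∀ j ∈ J₀, ∀ k ∈ K₀, fb j k ∈ B ∧ lB (fb j k) = (j, k)) ∧
      (∀ k ∈ K₀, ∀ i ∈ I₀, fc k i ∈ C ∧ lC (fc k i) = (k, i)) ∧
      (∀ i ∈ I₀, ∀ j ∈ J₀, ∀ k ∈ K₀, fa i j + fb j k + fc k i = t) := by
  obtain ⟨i₁, hi₁⟩ := hI
  obtain ⟨j₁, hj₁⟩ := hJ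
  obtain ⟨k₁, hk₁⟩ := hK
  have ea : ∀ i ∈ I₀, ∀ j ∈ J₀, ∃ a, a ∈ A ∧ lA a = (i, j) := by
    intro i hi j hj
    obtain ⟨a, ha, b, -, c, -, -, h1, -, -⟩ := hblk i hi j hj k₁ hk₁
    exact ⟨a, ha, h1⟩
  have eb : ∀ j ∈ J₀, ∀ k ∈ K₀, ∃ b, b ∈ B ∧ lB b = (j, k) := by
    intro j hj k hk
    obtain ⟨a, -, b, hb, c, -, -, -, h2, -⟩ := hblk i₁ hi₁ j hj k hk
    exact ⟨b, hb, h2⟩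
  have ec : ∀ k ∈ K₀, ∀ i ∈ I₀, ∃ c, c ∈ C ∧ lC c = (k, i) := by
    intro k hk i hi
    obtain ⟨a, -, b, -, c, hc, -, -, -, h3⟩ := hblk i hi j₁ hj₁ k hk
    exact ⟨c, hc, h3⟩
  choose! fa hfa using ea
  choose! fb hfb using eb
  choose! fc hfc using ec
  refine ⟨fa, fb, fc, hfa, hfb, hfc, ?_⟩
  intro i hi j hj k hk
  obtain ⟨a, ha, b, hb, c, hc, hs, h1, h2, h3⟩ := hblk i hi j hj k hk
  have e1 : a = fa i j := hL.1 ha (hfa i hi j hj).1 (h1.trans (hfa i hi j hj).2.symm)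
  have e2 : b = fb j k := hL.2.1 hb (hfb j hj k hk).1 (h2.trans (hfb j hj k hk).2.symm)
  have e3 : c = fc k i := hL.2.2.1 hc (hfc k hk i hi).1 (h3.trans (hfc k hk i hi).2.symm)
  rw [← e1, ← e2, ← e3]
  exact hs

/-- From the functional equation on a block: `fb j k - fb j k'` does not depend on `j` (it equals
`fc k' i₁ - fc k i₁` for any row `i₁` of the block). -/
theorem fb_add_fc_eq {fa : I → J → G} {fb : J → K → G} {fc : K → I → G}
    (hE : ∀ i ∈ I₀, ∀ j ∈ J₀, ∀ k ∈ K₀, fa i j + fb j k + fc k i = t)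
    {i₁ : I} (hi₁ : i₁ ∈ I₀) {j : J} (hj : j ∈ J₀) {k k' : K} (hk : k ∈ K₀) (hk' : k' ∈ K₀) :
    fb j k + fc k i₁ = fb j k' + fc k' i₁ := by
  have h1 := hE i₁ hi₁ j hj k hk
  have h2 := hE i₁ hi₁ j hj k' hk'
  have h1' : fb j k + fc k i₁ = t - fa i₁ j := by rw [← h1]; abel
  have h2' : fb j k' + fc k' i₁ = t - fa i₁ j := by rw [← h2]; abel
  rw [h1', h2']

/-- ONE COMPLETE BLOCK IS LINEAR (the abelian TPP packing bound in labelled form): a complete block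
`I₀ × J₀ × K₀` of a labelled triple in a finite additive commutative group satisfies `#I₀ · #J₀ · #K₀ ≤ |G|`.
The map `(i, j, k) ↦ fa i j + fb j₀ k` is injective on the box: a coincidence yields the solution
`fa i j + fb j' k + fc k' i' = t`, whose labels must match. -/
theorem Labelled.card_block_le [Fintype G] (hL : Labelled A B C t lA lB lC)
    (hblk : CompleteBlock A B C t lA lB lC I₀ J₀ K₀) :
    I₀.card * J₀.card * K₀.card ≤ Fintype.card G := by
  classical
  rcases I₀.eq_empty_or_nonempty with hI | hI
  · simp [hI]
  rcases J₀.eq_empty_or_nonempty with hJ | hJ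
  · simp [hJ]
  rcases K₀.eq_empty_or_nonempty with hK | hK
  · simp [hK]
  obtain ⟨fa, fb, fc, hfa, hfb, hfc, hE⟩ := hL.exists_blockFunctions hblk hI hJ hK
  obtain ⟨i₁, hi₁⟩ := hI
  obtain ⟨j₀, hj₀⟩ := hJ
  have hinj : Set.InjOn (fun p : I × J × K => fa p.1 p.2.1 + fb j₀ p.2.2) ↑(I₀ ×ˢ J₀ ×ˢ K₀) := by
    rintro ⟨i, j, k⟩ hp ⟨i', j', k'⟩ hp' he
    simp only [coe_product, Set.mem_prod, mem_coe] at hp hp'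
    obtain ⟨hi, hj, hk⟩ := hp
    obtain ⟨hi', hj', hk'⟩ := hp'
    simp only at he
    -- the coincidence produces an (a priori accidental) solution
    have E1 := hE i' hi' j' hj' k' hk'
    have Z := fb_add_fc_eq hE hi₁ hj' hk hk'
    have Z0 := fb_add_fc_eq hE hi₁ hj₀ hk hk'
    have h0' : fa i j = fa i' j' + fb j₀ k' - fb j₀ k := by rw [← he]; abel
    have hb' : fb j' k = fb j' k' + fc k' i₁ - fc k i₁ := by rw [← Z]; abel
    have hc' : fc k' i' = t - fa i' j' - fb j' k' := by rw [← E1]; abel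
    have hc'' : fc k' i₁ = fb j₀ k + fc k i₁ - fb j₀ k' := by rw [Z0]; abel
    have X : fa i j + fb j' k + fc k' i' = t := by
      rw [h0', hb', hc', hc'']
      abel
    -- whose labels must match
    have hm := hL.2.2.2 (fa i j) (hfa i hi j hj).1 (fb j' k) (hfb j' hj' k hk).1 (fc k' i') (hfc k' hk' i' hi').1 X
    rw [(hfa i hi j hj).2, (hfb j' hj' k hk).2, (hfc k' hk' i' hi').2] at hm
    obtain ⟨e1, e2, e3⟩ := hm
    simp only at e1 e2 e3
    subst e1; subst e2; subst e3
    rfl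
  have hmaps : Set.MapsTo (fun p : I × J × K => fa p.1 p.2.1 + fb j₀ p.2.2) ↑(I₀ ×ˢ J₀ ×ˢ K₀)
      ↑(univ : Finset G) := fun p _ => mem_coe.2 (mem_univ _)
  have h := card_le_card_of_injOn _ hmaps hinj
  rw [card_product, card_product, card_univ] at h
  simpa [mul_assoc] using h

/-- Hence a labelled triple consisting of one complete block — every solution has its labels in the box and every
label triple of the box occurs — has at most `|G|` solutions: a solution of a labelled triple is determined by its
label triple, so the solutions inject into the box. -/
theorem Labelled.card_solutionsG_le_of_block [DecidableEq G] [Fintype G] [DecidableEq I] [DecidableEq J] [DecidableEq K]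
    (hL : Labelled A B C t lA lB lC) (hblk : CompleteBlock A B C t lA lB lC I₀ J₀ K₀)
    (hin : ∀ p ∈ solutionsG A B C t, (lA p.1).1 ∈ I₀ ∧ (lA p.1).2 ∈ J₀ ∧ (lB p.2.1).2 ∈ K₀) :
    (solutionsG A B C t).card ≤ Fintype.card G := by
  refine le_trans ?_ (hL.card_block_le hblk)
  rw [← card_product, ← card_product]
  refine card_le_card_of_injOn (fun p => (((lA p.1).1, (lA p.1).2), (lB p.2.1).2)) ?_ ?_
  · intro p hp
    have h := hin p (mem_coe.1 hp)
    exact mem_coe.2 (mem_product.2 ⟨mem_product.2 ⟨h.1, h.2.1⟩, h.2.2⟩)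
  · intro p hp p' hp' he
    obtain ⟨hp1, hp2⟩ := mem_filter.1 (mem_coe.1 hp)
    obtain ⟨hp1', hp2'⟩ := mem_filter.1 (mem_coe.1 hp')
    simp only [mem_product] at hp1 hp1'
    simp only [Prod.mk.injEq] at he
    obtain ⟨⟨ei, ej⟩, ek⟩ := he
    have m := hL.2.2.2 p.1 hp1.1 p.2.1 hp1.2.1 p.2.2 hp1.2.2 hp2
    have m' := hL.2.2.2 p'.1 hp1'.1 p'.2.1 hp1'.2.1 p'.2.2 hp1'.2.2 hp2'
    -- a = a' from equal (i, j); then b, c from the sums? No: use labels throughout.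
    have ea : p.1 = p'.1 := hL.1 hp1.1 hp1'.1 (Prod.ext ei ej)
    have ejb : (lB p.2.1).1 = (lB p'.2.1).1 := by rw [← m.1, ← m'.1, ej]
    have eb : p.2.1 = p'.2.1 := hL.2.1 hp1.2.1 hp1'.2.1 (Prod.ext ejb ek)
    have ec : p.2.2 = p'.2.2 := by
      have h1 : p.2.2 = t - p.1 - p.2.1 := by rw [← hp2]; abel
      have h2 : p'.2.2 = t - p'.1 - p'.2.1 := by rw [← hp2']; abel
      rw [h1, h2, ea, eb]
    exact Prod.ext ea (Prod.ext eb ec)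

end CompleteBlock

end Summit.MatrixMultiplication.MatrixMultiplication.Theorems.SoloVal
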